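import Summits.ResolutionOfSingularities.ResolutionOfSingularities.Theorems.HilbertSamuelEliminationCampaignW42NearChainMovingExact
import Summits.ResolutionOfSingularities.ResolutionOfSingularities.Theorems.HilbertSamuelEliminationCampaignW42GeomDirDimNonincrease
import HarnessLib

/-!
# [OURS · L1 W4.2] The O2-type assemblies WITHOUT the binder CJS Thm. 3.10 (4): the summit and `SigmaMaxModifications` from the
# GRADED moving rows alone; item 19965 `TertiaryTermination p ↔ ∀ e, TertiaryTerminationMovingAt p e ↔ ∀ e, TertiaryInvariantLaxExists p e`
# outright (campaign s42, cell res-hironaka; host route HilbertSamuelElimination; `--supports`)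

Cell res-hironaka, slot W4.2 (★L-G4), statement campaign s42, seat res-L1-s42-pv-1 (gen 5). Pure proofs. The files
`…CampaignW42NearChainMovingClosed` / `…NearChainMovingExact` (res-L1-s42-pv-2 gen 3) assemble the summit from the graded moving rows and
prove the O2 equivalences MODULO `CossartJannsenSaito2020_thm_3_10_4`, consumed only as «`ē` does not increase along canonical near
steps» (`Helpers.closedOriginGeomDirDimNonincrease_of_thm_3_10_4`, `Helpers.geomDirDimNonincrease_of_thm_3_10_4`). Those two statements
are now theorems WITHOUT the binder (`CampaignW42.closedOriginGeomDirDimNonincrease_holds`, `CampaignW42.geomDirDimNonincrease_holds`,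
file `…CampaignW42GeomDirDimNonincrease`, from this generation's unconditional ridge monotonicity `ridgeDimDropAt_of_isNearPoint`);
this file re-runs the one-line assemblies with them:

* `maxOriginNoMoving_top_of_grades'` — GRADE JOIN at every level, no binder;
* **`resolutionOfSingularities_of_gradedMovingRows'`** — `(low-grade moving rows) → (top-grade moving rows) → ResolutionOfSingularities`
  with NO printed fact; `sigmaMaxModifications_of_gradedMovingRows'` likewise;
* `tertiaryTermination_of_movingAt`, **`tertiaryTermination_iff_movingAt'`**, **`tertiaryTermination_iff_laxSlots'`**,
  **`forall_tertiaryTermination_iff_laxSlots'`** — item 19965 as exact equivalences, no binder.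

Conditional theorems credit nothing: the moving rows / lax slots are OPEN from dimension three (obstruction O2 of CJS). AI bookkeeping,
weaker than expert review. NOTHING here is a statement of H. Hironaka's manuscript [Hironaka2017]; no new definition.

## References

* V. Cossart, U. Jannsen, S. Saito, LNM 2270 (2020), §1.3, Thm. 3.10 (4), Def. 6.15, Rem. 6.29 (1), p. 107. [CossartJannsenSaito2020]
* B. Dietel, Dissertation Regensburg (2015), Satz (8.2.7) (ii). [Dietel2015]
-/

noncomputable section

set_option linter.dupNamespace false -- mandated namespace of this single-conjunct summit

open CategoryTheory AlgebraicGeometry TopologicalSpace Topology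

namespace Summit.ResolutionOfSingularities.ResolutionOfSingularities.Theorems

namespace CampaignW42

open Literature.AlgebraicGeometry.Resolution Literature.RingTheory.HilbertSamuel
open Summit.ResolutionOfSingularities.ResolutionOfSingularities.Theses.HilbertSamuelElimination
open Summit.ResolutionOfSingularities.ResolutionOfSingularities.Theorems.SigmaMaxModificationsCorridor3
open Summit.ResolutionOfSingularities.ResolutionOfSingularities.Theorems.SigmaMaxModificationsCorridor3.Moving
open Summit.ResolutionOfSingularities.ResolutionOfSingularities.Theorems.SigmaMaxModificationsCorridor3.Helpers
open Summit.ResolutionOfSingularities.ResolutionOfSingularities.Cruxes.SigmaMaxModificationsCorridor3.WLadder (stub_movingCompactness)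

universe u

variable {p : ℕ}

/-! ## The graded form, no binder -/

/-- **GRADE JOIN at level `N`, unconditionally**: the low-grade (`ē ≤ 2`) and top-grade (`ē ≥ 3`) moving rows give the ungraded moving row
(`Moving.maxOriginNoMovingNearChainAt_all_of_grades'` with `closedOriginGeomDirDimNonincrease_holds`). [cite: CossartJannsenSaito2020, Rem. 6.29 (1)]
[cite: Dietel2015, Satz (8.2.7) (ii)] -/
theorem maxOriginNoMoving_top_of_grades' {N : ℕ}
    (hlow : MaxOriginNoMovingNearChainAt.{u} p N fun s => s.geomDirDim ≤ 2)
    (htop : MaxOriginNoMovingNearChainAt.{u} p N fun s => 3 ≤ s.geomDirDim) :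
    MaxOriginNoMovingNearChainAt.{u} p N fun _ => True :=
  maxOriginNoMovingNearChainAt_all_of_grades' (closedOriginGeomDirDimNonincrease_holds p N) hlow htop

/-- **THE SUMMIT FROM THE GRADED MOVING ROWS ALONE — no printed fact: the low-grade moving rows + the top-grade moving rows (all primes,
all levels) ⇒ `ResolutionOfSingularities`.** Conditional; credits nothing: the low rows are the key theorems' territory in dimension two and
beyond print from dimension three, the top rows are obstruction O2. [cite: CossartJannsenSaito2020, §1.3, Thm. 6.35, Thm. 6.40, p. 107] -/
theorem resolutionOfSingularities_of_gradedMovingRows'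
    (hlow : ∀ p : ℕ, p.Prime → ∀ N, MaxOriginNoMovingNearChainAt.{0} p N fun s => s.geomDirDim ≤ 2)
    (htop : ∀ p : ℕ, p.Prime → ∀ N, MaxOriginNoMovingNearChainAt.{0} p N fun s => 3 ≤ s.geomDirDim) :
    _root_.ResolutionOfSingularities :=
  resolutionOfSingularities_of_movingRows₀ fun p hp N => maxOriginNoMoving_top_of_grades' (hlow p hp N) (htop p hp N)

/-- The same for the parent crux `SigmaMaxModifications` (stmt-…-18506), no printed fact. [cite: CossartJannsenSaito2020, §1.3, Def. 6.15] -/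
theorem sigmaMaxModifications_of_gradedMovingRows'
    (hlow : ∀ p : ℕ, p.Prime → ∀ N, MaxOriginNoMovingNearChainAt.{0} p N fun s => s.geomDirDim ≤ 2)
    (htop : ∀ p : ℕ, p.Prime → ∀ N, MaxOriginNoMovingNearChainAt.{0} p N fun s => 3 ≤ s.geomDirDim) :
    SigmaMaxModifications :=
  sigmaMaxModifications_of_movingRows₀ fun p hp N => maxOriginNoMoving_top_of_grades' (hlow p hp N) (htop p hp N)

/-! ## Item 19965, no binder -/

/-- **ITEM 19965 off `Φ^{(N)}` FROM THE GRADED MOVING STATEMENTS — no binder** (L∞ by `stub_movingCompactness`, `ē`-monotonicity by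
`geomDirDimNonincrease_holds`). [cite: CossartJannsenSaito2020, p. 107] [cite: Dietel2015, Satz (8.2.7) (ii)] -/
theorem tertiaryTermination_offPhi_of_movingAt₁ (hmov : ∀ e, TertiaryTerminationMovingAt.{0} p e) :
    ∀ (R : ∀ S : Scheme.{0}, CentreSeq S → Prop), OracleFunctional R → OracleAdmissible R →
      ∀ (N : ℕ) (ν : ℕ → ℕ) (X : Scheme.{0}) [IsLocallyNoetherian X] (x : X), IsIsolatedOrigin p N ν X x →
        ν ≠ iterPSum N Phi → NoNearChainFrom R N ν (MarkedStage.init X x) fun _ => True :=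
  tertiaryTermination_offPhi_of_movingAt stub_movingCompactness (geomDirDimNonincrease_holds p) hmov

/-- **ITEM 19965 FROM THE GRADED MOVING STATEMENTS, all values `ν` — no binder** (an isolated origin is a maximal origin: Φ-lemma for
`ν = Φ^{(N)}`). [cite: CossartJannsenSaito2020, p. 107] [cite: Dietel2015, Satz (8.2.7) (ii)] -/
theorem tertiaryTermination_of_movingAt (hmov : ∀ e, TertiaryTerminationMovingAt.{0} p e) : TertiaryTermination.{0} p := by
  intro R hRf hRa N ν X _ x hX
  by_cases hν : ν = iterPSum N Phi
  · exact hX.isMaximalOrigin.noNearChainFrom_of_eq_iterPSum hRa hν _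
  · exact tertiaryTermination_offPhi_of_movingAt₁ hmov R hRf hRa N ν X x hX hν

/-- **`TertiaryTermination p ↔ ∀ e, TertiaryTerminationMovingAt p e` — no binder**: the isolated O2 item IS its graded MOVING part.
[cite: CossartJannsenSaito2020, p. 107] [cite: Dietel2015, Satz (8.2.7) (ii)] -/
theorem tertiaryTermination_iff_movingAt' : TertiaryTermination.{0} p ↔ ∀ e, TertiaryTerminationMovingAt.{0} p e :=
  ⟨movingAt_of_tertiaryTermination, tertiaryTermination_of_movingAt⟩

/-- **`TertiaryTermination p ↔ ∀ e, TertiaryInvariantLaxExists p e` — no binder**: item 19965 IS «a Cossart–Schober-shaped lax tertiary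
invariant exists at every grade». [cite: CossartJannsenSaito2020, §1.3, p. 107, App. Facts 18.28 (1)] [cite: Dietel2015, Satz (8.2.7) (ii)] -/
theorem tertiaryTermination_iff_laxSlots' : TertiaryTermination.{0} p ↔ ∀ e, TertiaryInvariantLaxExists.{0, 2} p e :=
  ⟨fun h e => tertiaryInvariantLaxExists_iff.mpr (movingAt_of_tertiaryTermination h e),
    fun h => tertiaryTermination_of_movingAt fun e => tertiaryInvariantLaxExists_iff.mp (h e)⟩

/-- **The filed item stmt-ResolutionOfSingularities-19965 verbatim on the left — no binder**:
`(∀ p prime, TertiaryTermination p) ↔ (∀ p prime, ∀ e, TertiaryInvariantLaxExists p e)`. [cite: CossartJannsenSaito2020, §1.3, p. 107]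
[cite: Dietel2015, Satz (8.2.7) (ii)] -/
theorem forall_tertiaryTermination_iff_laxSlots' :
    (∀ p : ℕ, p.Prime → TertiaryTermination.{0} p) ↔ ∀ p : ℕ, p.Prime → ∀ e, TertiaryInvariantLaxExists.{0, 2} p e :=
  ⟨fun h p hp => tertiaryTermination_iff_laxSlots'.mp (h p hp), fun h p hp => tertiaryTermination_iff_laxSlots'.mpr (h p hp)⟩

end CampaignW42

end Summit.ResolutionOfSingularities.ResolutionOfSingularities.Theorems

end
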